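import Mathlib
import HarnessLib
import Summits.Ventures.LatticeQCDFlow.Exactness.NCMCGeneralSpaceKishSampleSizeCorrelated
import Summits.Ventures.LatticeQCDFlow.Exactness.NCMCGeneralSpaceSampleSizeDilution

/-!
# NCMCGeneralSpaceKishSampleSizeDilution — the KISH DENOMINATOR along the restart chain needs
# `N_eff = N/(1 + 2α(1/ε − 1)) ≳ e^{L₂}` records, `α` the dilution constant of the bounded functions of
# the work — the same `α` as the Jarzynski lane

HONEST FRAMING: exact (Metropolis-corrected) sampling algorithms for lattice gauge theory;
figures of merit are autocorrelation/cost numbers at stated couplings and volumes; no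
continuum-physics claim.

Venture `LatticeQCDFlow` (cell pub-lqcd); FANOUT row 19 (`su2-snf`, GEN-9).  OUR WORK; nothing is
cited as a fact.  GEN-8's `Exactness/NCMCGeneralSpaceKishSampleSizeCorrelated` certifies the Kish
denominator `(1/N)Σ e^{−2W(εᵢ)}/E_F e^{−2W}` from correlated records with a variance-inflation factor `C`
of the WHOLE bounded class (restart chain: `2/ε − 1`).  As for the Jarzynski lane
(`…SampleSizeDilution`), the Chatterjee–Diaconis proof only uses the truncated summand
`1{ρ₂ ≤ a}·ρ₂`, `ρ₂ = e^{−2W}/Z₂` — a bounded function OF THE WORK — so the dilution constant `α` of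
the class `{φ(W) : φ bounded}` is what enters: `C = 1 + 2α(1/ε − 1)`.

* **`CrooksPair.kish_sampleSize_sufficient_of_workClassInflation`** — `e^{−2W} ∈ L¹(P_F)`; any `Q`
  with `P_F` marginals and `Var_Q(Σᵢ φ(W εᵢ)) ≤ C·N·Var_{P_F}(φ∘W)` for bounded measurable `φ`;
  `N ≥ e^{L₂ + t}` (`L₂ = KL(P₂ ‖ P_F)`, `P₂ = P_F.tilted(−2W)`) ⇒
  `E_Q|(1/N)Σ e^{−2W(εᵢ)}/E_F e^{−2W} − 1| ≤ √C·e^{−t/4} + 2√(P₂{L₂ + t/2 < log ρ₂})`;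
* **`CrooksPair.kish_sampleSize_sufficient_restartChain_dilution`** — the equilibrium restart chain
  with a `ν₀`-invariant level sampler `K`, `ε·ν̄₀ ≤ K(z, ·)` (`ε > 0`), and a dilution constant
  `α ≥ 0` of `{φ(W)}`: the same with **`C = 1 + 2α(1/ε − 1)`**.

Reading (value-free): the printed Kish ESS of `N` consecutive evolutions resolves its denominator once
`N/(1 + 2α(1/ε − 1)) ≳ e^{L₂}`; GEN-8's `2/ε − 1` is `α = 1`; row 19's F1/F2 weights have `ρ_w(1) ≈ 0`
(`≤ α·q^{n_between}`), i.e. the factor is `≈ 1` at the card's `n_between`.  NOT CLAIMED: numbers.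
-/

namespace Summit.Ventures.LatticeQCDFlow.Exactness.GeneralNCMC

open MeasureTheory ProbabilityTheory Set Filter Finset
open scoped ENNReal
open Literature.Probability.ImportanceSampling (isEstimate)

variable {Ω E : Type*} [MeasurableSpace Ω] [MeasurableSpace E]

namespace CrooksPair

variable {ν₀ ν₁ : Measure Ω} {κF κR : Kernel Ω E} {s e : E → Ω} {W : E → ℝ}

/-- The truncation `ψ_a(u) = (e^{−2u}/Z₂)·1{e^{−2u}/Z₂ ≤ a}` is a measurable function of the work … -/
theorem measurable_truncSqWork (Z a : ℝ) :
    Measurable fun u : ℝ => {u | Real.exp (-(2 * u)) / Z ≤ a}.indicator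
      (fun u => Real.exp (-(2 * u)) / Z) u := by
  have hm : Measurable fun u : ℝ => Real.exp (-(2 * u)) / Z :=
    (Real.measurable_exp.comp (measurable_const.mul measurable_id).neg).div_const Z
  exact hm.indicator (measurableSet_le hm measurable_const)

/-- … bounded by `a` (`a ≥ 0`, `Z > 0`). -/
theorem abs_truncSqWork_le {Z a : ℝ} (hZ : 0 < Z) (ha : 0 ≤ a) (u : ℝ) :
    |{u | Real.exp (-(2 * u)) / Z ≤ a}.indicator (fun u => Real.exp (-(2 * u)) / Z) u| ≤ a := by
  by_cases hu : u ∈ {u | Real.exp (-(2 * u)) / Z ≤ a}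
  · rw [Set.indicator_of_mem hu, abs_of_pos (div_pos (Real.exp_pos _) hZ)]; exact hu
  · rw [Set.indicator_of_notMem hu, abs_zero]; exact ha

/-- **KISH DENOMINATOR, CORRELATED RECORDS, WORK-CLASS VARIANCE INFLATION.**  See the module
docstring. [ours] -/
theorem kish_sampleSize_sufficient_of_workClassInflation [IsFiniteMeasure ν₀] [IsMarkovKernel κF]
    (h0 : ν₀ univ ≠ 0) (h : CrooksPair ν₀ ν₁ κF κR s e W)
    (hint : Integrable (fun ε => Real.exp (-(2 * W ε))) (fwdPathLaw ν₀ κF))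
    {N : ℕ} (Q : Measure (Fin N → E)) [IsProbabilityMeasure Q]
    (hmarg : ∀ i : Fin N, Q.map (fun x => x i) = fwdPathLaw ν₀ κF)
    {C : ℝ} (hC : 0 ≤ C)
    (hvar : ∀ φ : ℝ → ℝ, Measurable φ → ∀ B' : ℝ, (∀ u, |φ u| ≤ B') →
      Var[fun x : Fin N → E => ∑ i, φ (W (x i)); Q] ≤ C * N * Var[fun ε => φ (W ε); fwdPathLaw ν₀ κF])
    {t : ℝ}
    (hN : Real.exp ((∫ ε, (-(2 * W ε)
        - Real.log (∫ ε', Real.exp (-(2 * W ε')) ∂(fwdPathLaw ν₀ κF)))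
          ∂((fwdPathLaw ν₀ κF).tilted fun ε => -(2 * W ε))) + t) ≤ N) :
    ∫ x, |(1 / (N : ℝ)) * ∑ i, Real.exp (-(2 * W (x i)))
          / ∫ ε', Real.exp (-(2 * W ε')) ∂(fwdPathLaw ν₀ κF) - 1| ∂Q
      ≤ Real.sqrt C * Real.exp (-t / 4)
        + 2 * Real.sqrt (((fwdPathLaw ν₀ κF).tilted fun ε => -(2 * W ε))
          {ε | (∫ ε, (-(2 * W ε) - Real.log (∫ ε', Real.exp (-(2 * W ε')) ∂(fwdPathLaw ν₀ κF)))
              ∂((fwdPathLaw ν₀ κF).tilted fun ε => -(2 * W ε))) + t / 2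
            < -(2 * W ε) - Real.log (∫ ε', Real.exp (-(2 * W ε')) ∂(fwdPathLaw ν₀ κF))}).toReal := by
  haveI := isProbabilityMeasure_fwdPathLaw ν₀ h0 κF
  haveI : IsProbabilityMeasure ((fwdPathLaw ν₀ κF).tilted fun ε => -(2 * W ε)) :=
    isProbabilityMeasure_tilted hint
  set Z := ∫ ε', Real.exp (-(2 * W ε')) ∂(fwdPathLaw ν₀ κF) with hZ
  have hZpos : 0 < Z := integral_exp_pos hint
  set P₂ := (fwdPathLaw ν₀ κF).tilted fun ε => -(2 * W ε) with hP₂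
  -- the density `ρ₂ = e^{−2W}/Z₂`, `P_F`-a.e. and coordinatewise `Q`-a.e.
  have hrn' : ∀ᵐ ε ∂(fwdPathLaw ν₀ κF), (P₂.rnDeriv (fwdPathLaw ν₀ κF) ε).toReal
      = Real.exp (-(2 * W ε)) / Z := by
    filter_upwards [h.rnDeriv_sqTilt_ae h0] with ε hε
    rw [hε, ENNReal.toReal_ofReal (div_nonneg (Real.exp_pos _).le hZpos.le)]
  have hae : ∀ᵐ x ∂Q, ∀ i : Fin N,
      (P₂.rnDeriv (fwdPathLaw ν₀ κF) (x i)).toReal = Real.exp (-(2 * W (x i))) / Z := by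
    rw [ae_all_iff]
    intro i
    have hq : Measure.QuasiMeasurePreserving (fun x : Fin N → E => x i) Q (fwdPathLaw ν₀ κF) := by
      refine ⟨measurable_pi_apply i, ?_⟩
      rw [hmarg i]
    exact hq.ae hrn'
  -- the variance input on the truncated summands, from the work class
  have hvar' : ∀ a : ℝ, 0 < a →
      Var[fun x : Fin N → E => ∑ i,
          {y | (P₂.rnDeriv (fwdPathLaw ν₀ κF) y).toReal ≤ a}.indicator (fun _ => (1:ℝ)) (x i)
            * (P₂.rnDeriv (fwdPathLaw ν₀ κF) (x i)).toReal; Q]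
        ≤ C * N * Var[fun y =>
          {y | (P₂.rnDeriv (fwdPathLaw ν₀ κF) y).toReal ≤ a}.indicator (fun _ => (1:ℝ)) y
            * (P₂.rnDeriv (fwdPathLaw ν₀ κF) y).toReal; fwdPathLaw ν₀ κF] := by
    intro a ha
    set φ : ℝ → ℝ := fun u => {u | Real.exp (-(2 * u)) / Z ≤ a}.indicator
      (fun u => Real.exp (-(2 * u)) / Z) u with hφ
    have key := hvar φ (measurable_truncSqWork Z a) a (abs_truncSqWork_le hZpos ha.le)
    have hpt : ∀ y : E, (P₂.rnDeriv (fwdPathLaw ν₀ κF) y).toReal = Real.exp (-(2 * W y)) / Z →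
        {y | (P₂.rnDeriv (fwdPathLaw ν₀ κF) y).toReal ≤ a}.indicator (fun _ => (1:ℝ)) y
          * (P₂.rnDeriv (fwdPathLaw ν₀ κF) y).toReal = φ (W y) := by
      intro y hy
      simp only [hφ, Set.indicator, Set.mem_setOf_eq, hy]
      split_ifs <;> ring
    have hQae : (fun x : Fin N → E => ∑ i,
          {y | (P₂.rnDeriv (fwdPathLaw ν₀ κF) y).toReal ≤ a}.indicator (fun _ => (1:ℝ)) (x i)
            * (P₂.rnDeriv (fwdPathLaw ν₀ κF) (x i)).toReal)
        =ᵐ[Q] fun x => ∑ i, φ (W (x i)) := by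
      filter_upwards [hae] with x hx
      exact Finset.sum_congr rfl fun i _ => hpt (x i) (hx i)
    have hμae : (fun y =>
          {y | (P₂.rnDeriv (fwdPathLaw ν₀ κF) y).toReal ≤ a}.indicator (fun _ => (1:ℝ)) y
            * (P₂.rnDeriv (fwdPathLaw ν₀ κF) y).toReal)
        =ᵐ[fwdPathLaw ν₀ κF] fun y => φ (W y) := by
      filter_upwards [hrn'] with y hy
      exact hpt y hy
    rw [variance_congr hQae, variance_congr hμae]
    exact key
  have hgen := GeneralNCMC.sampleSize_sufficient_of_truncVarianceBound (fwdPathLaw ν₀ κF) P₂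
    (tilted_absolutelyContinuous _ _) (f := fun _ => (1 : ℝ)) measurable_const (B := 1)
    (fun _ => by simp) Q hmarg hC hvar' (t := t) (by rwa [integral_log_rnDeriv_sqTilt h0 hint])
  rw [integral_log_rnDeriv_sqTilt h0 hint] at hgen
  simp only [one_pow, integral_const, probReal_univ, smul_eq_mul, mul_one, Real.sqrt_one,
    one_mul] at hgen
  have hint' : (fun x : Fin N → E => |isEstimate (fwdPathLaw ν₀ κF) P₂ (fun _ => (1 : ℝ)) N x - 1|)
      =ᵐ[Q] fun x => |(1 / (N : ℝ)) * ∑ i, Real.exp (-(2 * W (x i))) / Z - 1| := by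
    filter_upwards [hae] with x hx
    simp only [isEstimate, one_mul]
    rw [Finset.sum_congr rfl fun i _ => hx i]
  have htail : {ε | (∫ ε, (-(2 * W ε) - Real.log Z) ∂P₂) + t / 2
        < Real.log (P₂.rnDeriv (fwdPathLaw ν₀ κF) ε).toReal}
      =ᵐ[P₂] ({ε | (∫ ε, (-(2 * W ε) - Real.log Z) ∂P₂) + t / 2
          < -(2 * W ε) - Real.log Z} : Set E) := by
    filter_upwards [(tilted_absolutelyContinuous _ _).ae_eq
      (log_rnDeriv_tilted_left_self hint)] with ε hε
    simp only [eq_iff_iff]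
    dsimp only [setOf]
    rw [hε]
  rw [integral_congr_ae hint', measure_congr htail] at hgen
  exact hgen

/-- **KISH DENOMINATOR ALONG THE RESTART CHAIN WITH DILUTION**: Crooks pair (`Z₀ ≠ 0`), `ν₀`-invariant
Markov `K` with `ε·(Z₀⁻¹ν₀)(B) ≤ K(z, B)` (`ε > 0`), `e^{−2W} ∈ L¹(P_F)`, a dilution constant `α ≥ 0` of
the bounded functions of the work; `N ≥ e^{L₂ + t}` consecutive evolutions.  Then
`E|(1/N)Σ_{i<N} e^{−2W(εᵢ)}/E_F e^{−2W} − 1| ≤ √(1 + 2α(1/ε − 1))·e^{−t/4} + 2√(P₂-tail)`. [ours] -/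
theorem kish_sampleSize_sufficient_restartChain_dilution (K : Kernel Ω Ω) [IsMarkovKernel K]
    [IsFiniteMeasure ν₀] [IsFiniteMeasure ν₁] [IsMarkovKernel κF] [IsMarkovKernel κR]
    (h0 : ν₀ univ ≠ 0) (hK : Kernel.Invariant K ν₀) (h : CrooksPair ν₀ ν₁ κF κR s e W)
    (hint : Integrable (fun ε => Real.exp (-(2 * W ε))) (fwdPathLaw ν₀ κF))
    {ε : ℝ≥0∞} (hε0 : 0 < ε)
    (hmin : ∀ z (B : Set Ω), MeasurableSet B → ε * ((ν₀ univ)⁻¹ • ν₀) B ≤ K z B)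
    {α : ℝ} (hα0 : 0 ≤ α)
    (hα : ∀ φ : ℝ → ℝ, Measurable φ → ∀ B' : ℝ, (∀ u, |φ u| ≤ B') →
      Var[fun z => ∫ ω, φ (W ω) ∂(κF z); (ν₀ univ)⁻¹ • ν₀] ≤ α * Var[fun ω => φ (W ω); fwdPathLaw ν₀ κF])
    {N : ℕ} {t : ℝ}
    (hN : Real.exp ((∫ ε', (-(2 * W ε')
        - Real.log (∫ ε'', Real.exp (-(2 * W ε'')) ∂(fwdPathLaw ν₀ κF)))
          ∂((fwdPathLaw ν₀ κF).tilted fun ε' => -(2 * W ε'))) + t) ≤ N) :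
    haveI := isProbabilityMeasure_fwdPathLaw ν₀ h0 κF
    ∫ x, |(1 / (N : ℝ)) * ∑ i ∈ range N, Real.exp (-(2 * W (x i)))
          / ∫ ε', Real.exp (-(2 * W ε')) ∂(fwdPathLaw ν₀ κF) - 1|
        ∂(Kernel.trajMeasure (X := fun _ : ℕ => E) (fwdPathLaw ν₀ κF)
          (fun n : ℕ => ((κF ∘ₖ K).comap s h.measurable_s).comap
            (fun hh : (j : ↥(Finset.Iic n)) → E => hh ⟨n, Finset.mem_Iic.2 le_rfl⟩)
            (measurable_pi_apply _)))
      ≤ Real.sqrt (1 + 2 * α * (1 / ε.toReal - 1)) * Real.exp (-t / 4)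
        + 2 * Real.sqrt (((fwdPathLaw ν₀ κF).tilted fun ε' => -(2 * W ε'))
          {ε' | (∫ ε', (-(2 * W ε')
              - Real.log (∫ ε'', Real.exp (-(2 * W ε'')) ∂(fwdPathLaw ν₀ κF)))
                ∂((fwdPathLaw ν₀ κF).tilted fun ε' => -(2 * W ε'))) + t / 2
            < -(2 * W ε') - Real.log (∫ ε'', Real.exp (-(2 * W ε'')) ∂(fwdPathLaw ν₀ κF))}).toReal := by
  haveI := isProbabilityMeasure_fwdPathLaw ν₀ h0 κF
  haveI : IsProbabilityMeasure ((ν₀ univ)⁻¹ • ν₀) := by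
    constructor
    rw [Measure.smul_apply, smul_eq_mul, ENNReal.inv_mul_cancel h0 (measure_ne_top _ _)]
  set R := (κF ∘ₖ K).comap s h.measurable_s with hR
  set P := Kernel.trajMeasure (X := fun _ : ℕ => E) (fwdPathLaw ν₀ κF)
      (fun n : ℕ => R.comap (fun hh : (j : ↥(Finset.Iic n)) → E => hh ⟨n, Finset.mem_Iic.2 le_rfl⟩)
        (measurable_pi_apply _)) with hP
  have hπ : Kernel.Invariant R (fwdPathLaw ν₀ κF) := h.invariant_restartKernel K hK
  have hr : Measurable (fun (x : ℕ → E) (j : Fin N) => x j) :=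
    measurable_pi_lambda _ fun j => measurable_pi_apply _
  set Q := P.map (fun (x : ℕ → E) (j : Fin N) => x j) with hQ
  haveI : IsProbabilityMeasure Q := Measure.isProbabilityMeasure_map hr.aemeasurable
  have hmarg : ∀ i : Fin N, Q.map (fun y => y i) = fwdPathLaw ν₀ κF := fun i => by
    rw [hQ, Measure.map_map (measurable_pi_apply i) hr, hP]
    exact chain_map_eval_of_invariant R hπ i
  have hε1 : ε ≤ 1 :=
    Scoring.eps_le_one_of_doeblin (κ := K) (π := (ν₀ univ)⁻¹ • ν₀) (fun x B hB => hmin x B hB)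
  have hεr0 : 0 < ε.toReal :=
    ENNReal.toReal_pos hε0.ne' (ne_top_of_le_ne_top ENNReal.one_ne_top hε1)
  have hεr : ε.toReal ≤ 1 := by
    have := ENNReal.toReal_mono ENNReal.one_ne_top hε1
    simpa using this
  have hC0 : 0 ≤ 1 + 2 * α * (1 / ε.toReal - 1) := by
    have : 0 ≤ 1 / ε.toReal - 1 := by rw [sub_nonneg, le_div_iff₀ hεr0]; linarith
    positivity
  have hvar : ∀ φ : ℝ → ℝ, Measurable φ → ∀ B' : ℝ, (∀ u, |φ u| ≤ B') →
      Var[fun x : Fin N → E => ∑ i, φ (W (x i)); Q]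
        ≤ (1 + 2 * α * (1 / ε.toReal - 1)) * N * Var[fun ω => φ (W ω); fwdPathLaw ν₀ κF] := by
    intro φ hφ B' hB'
    have hGm : Measurable fun ω => φ (W ω) := hφ.comp h.measurable_W
    have hGb : ∀ ω, |φ (W ω)| ≤ B' := fun ω => hB' _
    rw [hQ, hP]
    exact h.variance_sum_restartChain_le_of_dilution K h0 hK hε0 hmin hGm hGb (hα φ hφ B' hB') N
  have key := h.kish_sampleSize_sufficient_of_workClassInflation h0 hint Q hmarg hC0 hvar hN
  -- back to the trajectory measure
  have hintm : Measurable (fun y : Fin N → E => |(1 / (N : ℝ)) * ∑ i, Real.exp (-(2 * W (y i)))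
      / ∫ ε', Real.exp (-(2 * W ε')) ∂(fwdPathLaw ν₀ κF) - 1|) := by
    have hW := h.measurable_W
    refine Measurable.abs ((measurable_const.mul (Finset.measurable_sum _ fun i _ => ?_)).sub
      measurable_const)
    exact (Real.measurable_exp.comp ((measurable_const.mul (hW.comp (measurable_pi_apply i))).neg)).div_const _
  rw [hQ, integral_map hr.aemeasurable hintm.aestronglyMeasurable] at key
  have hcomp : ∀ x : ℕ → E, (∑ i : Fin N, Real.exp (-(2 * W (x i)))
      / ∫ ε', Real.exp (-(2 * W ε')) ∂(fwdPathLaw ν₀ κF))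
      = ∑ i ∈ range N, Real.exp (-(2 * W (x i)))
        / ∫ ε', Real.exp (-(2 * W ε')) ∂(fwdPathLaw ν₀ κF) := fun x =>
    Fin.sum_univ_eq_sum_range (fun i => Real.exp (-(2 * W (x i)))
      / ∫ ε', Real.exp (-(2 * W ε')) ∂(fwdPathLaw ν₀ κF)) N
  simp only [hcomp] at key
  exact key

end CrooksPair

end Summit.Ventures.LatticeQCDFlow.Exactness.GeneralNCMC
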